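/-
Copyright (c) 2026 the pub-hodgecm-mathlib formalisation cell (harness21).  Prover seat hodgecm-mathlib-K2Liu-p23 (g3), Track B «K2-LIT»,
#184♮ = hLiu418 = `stmt-HodgeConjecture-24832`; #42F′ FACE-G organ F4 (G-gen), road (E), B3-b: THE (E-g-glue) — ★ FILE 3's LAST LETTER (partner) AT
`t := tupleVec` FROM THE (E-g) «POLYNOMIAL PARTNER» HEAD BY VALUE (F4 lead K2Liu-p27 (g2) DEAL 2026-09-05T00:15:09Z).
KERNEL: theorems only.
-/
import Summits.HodgeConjecture.HodgeConjecture.Theorems.K2LiuArchSWDataTuplesDefs     -- ★ B3-b FILE 1 (LH7-p07): `tuplePoly`, `tupleVecOf`, `tupleVec`, `frameSlotEquiv_inr`, `tuplePoly_update`, `tuplePoly_one`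
import Summits.HodgeConjecture.HodgeConjecture.Theorems.K2LiuFockInvariantsHermite    -- ★ (E-e) (K2E3-p23): `mem_span_range_hermitePi_iff` (finite Hermite combinations = `range binvPi`)
import Summits.HodgeConjecture.HodgeConjecture.Theorems.K2LiuFaceGLetterDefs         -- ★ p862888: `IsArchStable`, `genFamily` (the letters' predicates of record)
import Summits.HodgeConjecture.HodgeConjecture.Theorems.K2LiuArchSWPolynomialPartner  -- ★ p863527 (E-g) HEAD (LH7-p05): `partner_letter_of_finiteRange` (ED. 2)
import HarnessLib

/-!
# Crux `HLiu418`, FACE-G organ F4, road (E), B3-b (E-g-glue): THE TUPLE VECTORS SPAN EXACTLY THE FOCK-FINITE VECTORS OF THE BIG FRAME, AND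
# ★ FILE 3's LETTER (partner) AT `t := tupleVec` FROM THE (E-g) POLYNOMIAL-PARTNER HEAD BY VALUE

Cell `hodgecm-mathlib`, crux item hLiu418 = `stmt-HodgeConjecture-24832`, route of record `HCCMUnconditional`; squad K2 ∕ K2Liu, socket #42F′, FACE-G organ
F4 (G-gen), road (E), B3-b; F4 lead K2Liu-p27 (g2) (DEAL 00:15:09Z), consumers K2E3-p23 (g8) ★ FILE 3 `K2LiuArchSWDataFinalPassage` ∕ LH7-p07 (g2)
`K2LiuArchSWDataInductionFinal`, (E-g) HEAD LH7-p05 (g2); box K2Liu-audit1.  THEOREMS ONLY (no `def`, no `instance`, no `notation`, no named-fact hypothesis,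
no `sorry`); lane `--supports stmt-HodgeConjecture-24832 --as helper` (count-neutral helper, closes no socket).

WHAT.  ★ FILE 3 `forall_domain_good_of_archGenerators` (:170–173) takes, for its generating family `t`, the letter
(partner) `∀ V fd arch-stable, ∀ a ∈ V, ∀ f, ∃ w ∈ span (range t), g_{E(w ⊗ f)} = g_{E(a ⊗ f)}`.  The (E-g) «polynomial partner» head (★ (E-g-core)
`exists_partner_of_tendsto_seq` ∘ ★ (E-g-an) `K2LiuArchSWDegreeTruncation` ∕ `K2LiuArchSWSectionContinuity` ∘ ★ (E-g-fin)) produces the partner `w` in the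
FOCK-FINITE vectors of the big scaled Folland frame `frameD` — `w ∈ span (range (follandHermite frameD))`, equivalently `w = frameD^*⁻¹ (B⁻¹ F)` for a polynomial
`F`.  THIS FILE proves that these are EXACTLY `span (range tupleVec)` (★ FILE 1's tuple vectors), so the head gives (partner) at `t := tupleVec` by monotonicity.
* §1 GENERIC POLYNOMIAL SLOTS (★ FILE 1 §1's `u Ξ`; ONLY FILE 1's `hinr` is needed — the `inr`-block of `Ξ_σ` is the identity on the other places, so every
  coordinate `(i, σ)` is a `σ`-slot): `exists_slot_eq`; `X_slot_mul_tuplePoly` — `X_{slot j} · tuplePoly a = tuplePoly (update a σ (X_j · a σ))` (★ `tuplePoly_update`);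
  `mul_X_mem_span_range_tuplePoly`; **`span_range_tuplePoly_eq_top`** — the global Fock polynomials of tuples SPAN `ℂ[ι × Ω]` (`MvPolynomial.induction_on`:
  constants are multiples of the all-vacuum tuple ★ `tuplePoly_one`, and the span is stable under every `· X_x`).
* §2 GENERIC FOLLAND FRAME `e` (★ FILE 1 §2's `tupleVecOf e`): `symm_binvPi_mem_span_range_tupleVecOf` (`e^*⁻¹ B⁻¹F ∈ span (range tupleVecOf)`),
  `follandHermite_mem_span_range_tupleVecOf`, `tupleVecOf_mem_span_range_follandHermite` (★ `mem_span_range_hermitePi_iff`),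
  **`span_range_tupleVecOf_eq_span_range_follandHermite`**, `mem_span_range_tupleVecOf_iff` (`↔ ∃ F, w = e^*⁻¹ B⁻¹F`).
* §3 THE BIG DATUM (★ FILE 1 §3's `tupleVec`, any block data `P Q R S eP eQ`; `hinr := frameSlotEquiv_inr`): `follandHermite_frameD_mem_span_range_tupleVec`,
  **`span_range_tupleVec_eq_span_range_follandHermite`**, `span_range_follandHermite_le_span_range_tupleVec`, **`mem_span_range_tupleVec_of_fockFinite`**,
  `mem_span_range_tupleVec_of_mem_span_follandHermite`, `mem_span_range_tupleVec_iff`.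
* §4 (partner) AT THE MODEL (`P = Q = Fin 2`, ★ FILE 3 ∕ ★ Final binders): **`hpartner_of_partnerIn`** — from a head valued in ANY `Pf ≤ span (range tupleVec)` to
  ★ FILE 3's `hpartner` at `t := tupleVec` VERBATIM; the two readings **`hpartner_of_hermitePartner`** (`Pf := span (range (follandHermite frameD))`, LH7-p05's
  announced currency `P := span (range (follandHermite frameD))`) and **`hpartner_of_polynomialPartner`** (`∃ F, w = frameD^*⁻¹ (B⁻¹ F)`).
* §5 (ED. 2) THE COMPOSITION WITH THE ★ (E-g) HEAD p863527: **`hpartner_of_finiteRange`** — ★ FILE 3's `hpartner` at `t := tupleVec` from the head's ONE letter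
  `hfin` BY VALUE (bytes of ★ `K2LiuArchSWPolynomialPartner.partner_letter_of_finiteRange` VERBATIM: «the Siegel–Weil sections of the degree truncations of `V`
  span a finite-dimensional space of functions on `H(𝔸)`»), = `hpartner_of_hermitePartner ∘ partner_letter_of_finiteRange`.
References: [Folland1989] §1.7 (1.81) (the Hermite ∕ Fock-monomial basis), §4.2 Prop. (4.39); [Howe1989] §3 (Fock-finite vectors = polynomial Fock model) —
citations only, the file is linear algebra over ★ FILE 1.
HONEST LABEL.  Count-neutral helper: `HC_CM` is proved only modulo the 7 printed citations (2 remaining named inputs: hLiu418 = `stmt-HodgeConjecture-24832`,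
h413 = `stmt-HodgeConjecture-24833`) until rung 0 closes; this file closes no socket.
-/

set_option autoImplicit false
set_option linter.dupNamespace false -- the mandated namespace repeats `HodgeConjecture.HodgeConjecture`

noncomputable section

open scoped Classical Matrix TensorProduct Kronecker SchwartzMap
open MvPolynomial
open NumberField NumberField.InfinitePlace NumberField.mixedEmbedding IsDedekindDomain
open Literature.Analysis.SegalBargmann Literature.RepresentationTheory.HeisenbergGroup
open Literature.NumberTheory.Automorphic Literature.NumberTheory.Automorphic.UnitaryGroup Literature.NumberTheory.GaloisRepresentations
open Literature.NumberTheory.Weil1964 Literature.NumberTheory.Weil1964.MpS Literature.NumberTheory.Weil1964.UnitaryWeil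
open Literature.RepresentationTheory.HarrisKudlaSweet1996
open Literature.RepresentationTheory.KonnoKonno2007 Literature.RepresentationTheory.KonnoKonno2007.RealDualPair
open Literature.NumberTheory.GelbartRogawski1991 Literature.NumberTheory.GelbartRogawski1991.GRConstruction
open Literature.NumberTheory.GelbartRogawski1991.UnitaryDualPair
open Literature.NumberTheory.GelbartRogawski1991.UnitaryDualPair.LocalSplitting
open Literature.NumberTheory.K2Lit.SiegelDoubled
open Literature.NumberTheory.Automorphic.Liu2021
open Literature.NumberTheory.Automorphic.Liu2021.Def411WeilCarriers
open Literature.NumberTheory.Automorphic.Liu2021.Def411WeilCarriersDoubling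
open Literature.RepresentationTheory.Liu2021
open Summit.HodgeConjecture.HodgeConjecture.Cruxes.HLiu418.K2LiuArchSectionPlaceBlock
open Summit.HodgeConjecture.HodgeConjecture.Cruxes.HLiu418.K2LiuArchSWDataTuplesDefs
open Summit.HodgeConjecture.HodgeConjecture.Cruxes.HLiu418.K2LiuFockInvariantsHermite (mem_span_range_hermitePi_iff)
open Summit.HodgeConjecture.HodgeConjecture.Cruxes.HLiu418.K2LiuFaceGLetterDefs (IsArchStable genFamily)

namespace Summit.HodgeConjecture.HodgeConjecture.Cruxes.HLiu418.K2LiuArchSWDataPartnerGlue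

/-! ## §1 Generic polynomial slots: the global Fock polynomials of tuples span `ℂ[ι × Ω]` -/

section PolySlots

variable {Ω : Type*} {ι : Type*} {J A : Ω → Type*}
  (u : (σ : Ω) → J σ ≃ A σ) (Ξ : (σ : Ω) → (A σ ⊕ (ι × {v : Ω // v ≠ σ})) ≃ (ι × Ω))
  (hinr : ∀ (σ : Ω) (x : ι × {v : Ω // v ≠ σ}), Ξ σ (Sum.inr x) = (x.1, x.2.1))

include hinr in
/-- **EVERY COORDINATE IS A SLOT**: since the `inr`-block of `Ξ_σ` is the identity on the other places (★ FILE 1's `hinr`), every coordinate `x = (i, σ)` of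
`ι × Ω` is `Ξ_σ (inl (u_σ j))` for a (unique) `j : J_σ` — `(Ξ_σ)⁻¹ x = inr y` would force `σ = x.2 = y.2.1 ≠ σ`. [folklore] -/
theorem exists_slot_eq (x : ι × Ω) : ∃ j : J x.2, Ξ x.2 (Sum.inl (u x.2 j)) = x := by
  rcases h : (Ξ x.2).symm x with z | y
  · exact ⟨(u x.2).symm z, by rw [Equiv.apply_symm_apply, ← h, Equiv.apply_symm_apply]⟩
  · have hx : x = (y.1, (y.2 : Ω)) := by rw [← hinr, ← h, Equiv.apply_symm_apply]
    exact absurd (congrArg Prod.snd hx).symm y.2.2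

variable [Fintype Ω] [DecidableEq Ω]

/-- **A SLOT VARIABLE TIMES A TUPLE POLYNOMIAL IS A TUPLE POLYNOMIAL**: `X_{Ξ_σ(inl (u_σ j))} · tuplePoly a = tuplePoly (update a σ (X_j · a σ))`
(★ FILE 1 `tuplePoly_update`: the `σ`-slot is a factor). [cite: Folland1989, §1.7 (1.81)] -/
theorem X_slot_mul_tuplePoly (σ : Ω) (j : J σ) (a : (τ : Ω) → MvPolynomial (J τ) ℂ) :
    X (Ξ σ (Sum.inl (u σ j))) * tuplePoly u Ξ a = tuplePoly u Ξ (Function.update a σ (X j * a σ)) := by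
  have h := tuplePoly_update u Ξ σ a (a σ)
  rw [Function.update_eq_self] at h
  rw [h, tuplePoly_update, map_mul, rename_X, mul_assoc]

include hinr in
/-- the span of the tuple polynomials is stable under multiplication by every variable `X_x` (`x` is a slot, `exists_slot_eq`). [folklore] -/
theorem mul_X_mem_span_range_tuplePoly (x : ι × Ω) {p : MvPolynomial (ι × Ω) ℂ} (hp : p ∈ Submodule.span ℂ (Set.range (tuplePoly u Ξ))) :
    p * X x ∈ Submodule.span ℂ (Set.range (tuplePoly u Ξ)) := by
  obtain ⟨j, hj⟩ := exists_slot_eq u Ξ hinr x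
  refine Submodule.span_induction (p := fun q _ => q * X x ∈ Submodule.span ℂ (Set.range (tuplePoly u Ξ))) ?_ ?_ ?_ ?_ hp
  · rintro _ ⟨a, rfl⟩
    rw [mul_comm, ← hj, X_slot_mul_tuplePoly]
    exact Submodule.subset_span ⟨_, rfl⟩
  · rw [zero_mul]
    exact Submodule.zero_mem _
  · intro q r _ _ hq hr
    rw [add_mul]
    exact Submodule.add_mem _ hq hr
  · intro c q _ hq
    rw [smul_mul_assoc]
    exact Submodule.smul_mem _ c hq

include hinr in
/-- **THE TUPLE POLYNOMIALS SPAN THE GLOBAL FOCK POLYNOMIAL RING**: `span ℂ (range (tuplePoly u Ξ)) = ⊤` — constants are multiples of the all-vacuum tuple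
(★ `tuplePoly_one`), and the span is stable under `· X_x` for every coordinate `x` (`mul_X_mem_span_range_tuplePoly`), so `MvPolynomial.induction_on` concludes;
equivalently every monomial of `ℂ[ι × Ω]` is the tuple polynomial of the tuple of its place-monomials. [cite: Folland1989, §1.7 (1.81)] [cite: Howe1989, §3] -/
theorem span_range_tuplePoly_eq_top : Submodule.span ℂ (Set.range (tuplePoly u Ξ)) = ⊤ := by
  refine Submodule.eq_top_iff'.mpr fun F => ?_
  induction F using MvPolynomial.induction_on with
  | C c =>
    have hC : (C c : MvPolynomial (ι × Ω) ℂ) = c • tuplePoly u Ξ (fun _ => (1 : MvPolynomial (J _) ℂ)) := by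
      rw [tuplePoly_one, smul_eq_C_mul, mul_one]
    rw [hC]
    exact Submodule.smul_mem _ c (Submodule.subset_span ⟨_, rfl⟩)
  | add p q hp hq => exact Submodule.add_mem _ hp hq
  | mul_X p x hp => exact mul_X_mem_span_range_tuplePoly u Ξ hinr x hp

include hinr in
/-- every global Fock polynomial is a finite linear combination of tuple polynomials. [cite: Folland1989, §1.7 (1.81)] -/
theorem mem_span_range_tuplePoly (F : MvPolynomial (ι × Ω) ℂ) : F ∈ Submodule.span ℂ (Set.range (tuplePoly u Ξ)) := by
  rw [span_range_tuplePoly_eq_top u Ξ hinr]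
  exact Submodule.mem_top

end PolySlots

/-! ## §2 Generic Folland frame `e`: the tuple vectors span exactly the Fock-finite vectors `e^*⁻¹ (B⁻¹ F)` = `span (range (follandHermite e))` -/

section Schwartz

variable {Ω : Type*} [Fintype Ω] [DecidableEq Ω] {ι : Type*} [Fintype ι] [DecidableEq ι] {J A : Ω → Type*}
  (u : (σ : Ω) → J σ ≃ A σ) (Ξ : (σ : Ω) → (A σ ⊕ (ι × {v : Ω // v ≠ σ})) ≃ (ι × Ω))
  {D : Type*} [NormedAddCommGroup D] [NormedSpace ℝ D] (e : D ≃L[ℝ] ((ι × Ω) → ℝ))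
  (hinr : ∀ (σ : Ω) (x : ι × {v : Ω // v ≠ σ}), Ξ σ (Sum.inr x) = (x.1, x.2.1))

include hinr in
/-- **EVERY POLYNOMIAL × GAUSSIAN VECTOR OF THE FRAME IS A COMBINATION OF TUPLE VECTORS**: `e^*⁻¹ (B⁻¹ F) ∈ span (range (tupleVecOf e))`
(`tupleVecOf e a = e^*⁻¹ (B⁻¹ (tuplePoly a))`, ★ FILE 1; `F ∈ span (range tuplePoly)` by §1; `B⁻¹` and `e^*⁻¹` are linear). [cite: Folland1989, §1.7 (1.81)] -/
theorem symm_binvPi_mem_span_range_tupleVecOf (F : MvPolynomial (ι × Ω) ℂ) :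
    (schwartzTransport e).symm (binvPi F) ∈ Submodule.span ℂ (Set.range (tupleVecOf u Ξ e)) := by
  refine Submodule.span_induction (p := fun G _ => (schwartzTransport e).symm (binvPi G) ∈ Submodule.span ℂ (Set.range (tupleVecOf u Ξ e)))
    ?_ ?_ ?_ ?_ (mem_span_range_tuplePoly u Ξ hinr F)
  · rintro _ ⟨a, rfl⟩
    exact Submodule.subset_span ⟨a, rfl⟩
  · rw [← binvPiₗ_apply, map_zero, map_zero]
    exact Submodule.zero_mem _
  · intro G H _ _ hG hH
    rw [binvPi_add, map_add]
    exact Submodule.add_mem _ hG hH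
  · intro c G _ hG
    rw [binvPi_smul, map_smul]
    exact Submodule.smul_mem _ c hG

include hinr in
/-- **THE HERMITE FUNCTIONS OF THE FRAME ARE COMBINATIONS OF TUPLE VECTORS**: `follandHermite e β ∈ span (range (tupleVecOf e))`
(`follandHermite e β = e^*⁻¹ h_β = e^*⁻¹ (B⁻¹ ζ_β)`, ★ `binvPi_zeta`). [cite: Folland1989, §1.7 (1.81)] -/
theorem follandHermite_mem_span_range_tupleVecOf (β : (ι × Ω) →₀ ℕ) :
    follandHermite e β ∈ Submodule.span ℂ (Set.range (tupleVecOf u Ξ e)) := by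
  rw [follandHermite, ← binvPi_zeta]
  exact symm_binvPi_mem_span_range_tupleVecOf u Ξ e hinr (zeta β)

/-- **THE TUPLE VECTORS ARE FOCK-FINITE**: `tupleVecOf e a ∈ span (range (follandHermite e))` (`B⁻¹ (tuplePoly a)` is a finite Hermite combination, ★
`mem_span_range_hermitePi_iff`, pushed through the linear `e^*⁻¹`). [cite: Folland1989, §1.7 (1.81)] [cite: Howe1989, §3] -/
theorem tupleVecOf_mem_span_range_follandHermite (a : (σ : Ω) → MvPolynomial (J σ) ℂ) :
    tupleVecOf u Ξ e a ∈ Submodule.span ℂ (Set.range (follandHermite e)) := by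
  have h : binvPi (tuplePoly u Ξ a) ∈ Submodule.span ℂ (Set.range (hermitePi (σ := ι × Ω))) :=
    (mem_span_range_hermitePi_iff _).mpr ⟨_, rfl⟩
  rw [tupleVecOf]
  refine Submodule.span_induction (p := fun g _ => (schwartzTransport e).symm g ∈ Submodule.span ℂ (Set.range (follandHermite e))) ?_ ?_ ?_ ?_ h
  · rintro _ ⟨β, rfl⟩
    exact Submodule.subset_span ⟨β, rfl⟩
  · rw [map_zero]
    exact Submodule.zero_mem _
  · intro g g' _ _ hg hg'
    rw [map_add]
    exact Submodule.add_mem _ hg hg'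
  · intro c g _ hg
    rw [map_smul]
    exact Submodule.smul_mem _ c hg

include hinr in
/-- **THE TUPLE VECTORS SPAN EXACTLY THE FOCK-FINITE VECTORS OF THE FRAME**: `span (range (tupleVecOf e)) = span (range (follandHermite e))`.
[cite: Folland1989, §1.7 (1.81)] [cite: Howe1989, §3] -/
theorem span_range_tupleVecOf_eq_span_range_follandHermite :
    Submodule.span ℂ (Set.range (tupleVecOf u Ξ e)) = Submodule.span ℂ (Set.range (follandHermite e)) := by
  apply le_antisymm
  · rw [Submodule.span_le]
    rintro _ ⟨a, rfl⟩
    exact tupleVecOf_mem_span_range_follandHermite u Ξ e a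
  · rw [Submodule.span_le]
    rintro _ ⟨β, rfl⟩
    exact follandHermite_mem_span_range_tupleVecOf u Ξ e hinr β

include hinr in
/-- **THE POLYNOMIAL READING**: `w ∈ span (range (tupleVecOf e)) ↔ ∃ F, w = e^*⁻¹ (B⁻¹ F)`. [cite: Folland1989, §1.7 (1.81)] [cite: Howe1989, §3] -/
theorem mem_span_range_tupleVecOf_iff (w : 𝓢(D, ℂ)) :
    w ∈ Submodule.span ℂ (Set.range (tupleVecOf u Ξ e)) ↔ ∃ F : MvPolynomial (ι × Ω) ℂ, w = (schwartzTransport e).symm (binvPi F) := by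
  constructor
  · intro hw
    refine Submodule.span_induction (p := fun x _ => ∃ F : MvPolynomial (ι × Ω) ℂ, x = (schwartzTransport e).symm (binvPi F)) ?_ ?_ ?_ ?_ hw
    · rintro _ ⟨a, rfl⟩
      exact ⟨tuplePoly u Ξ a, rfl⟩
    · exact ⟨0, by rw [← binvPiₗ_apply, map_zero, map_zero]⟩
    · rintro x y _ _ ⟨F, rfl⟩ ⟨G, rfl⟩
      exact ⟨F + G, by rw [binvPi_add, map_add]⟩
    · rintro c x _ ⟨F, rfl⟩
      exact ⟨c • F, by rw [binvPi_smul, map_smul]⟩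
  · rintro ⟨F, rfl⟩
    exact symm_binvPi_mem_span_range_tupleVecOf u Ξ e hinr F

end Schwartz

/-! ## §3 The BIG datum `𝔻 ⊗ V′`: `span (range tupleVec)` = the Fock-finite vectors of the big scaled Folland frame `frameD` -/

section BigDatum

variable (L : Type) [Field L] [NumberField L] [IsCMField L]
variable {N M : ℕ}
  (dV : Fin N → L) (hdV : ∀ i, IsCMField.complexConj L (dV i) = dV i) (hdV0 : ∀ i, dV i ≠ 0)
  (dW : Fin M → L) (hdW : ∀ i, IsCMField.complexConj L (dW i) = dW i) (hdW0 : ∀ i, dW i ≠ 0)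
variable {M₂ M' n' : ℕ} (eW : Fin M × Fin M₂ ≃ Fin M') (e' : Fin N × Fin M' ≃ Fin n')
  (dV' : Fin M₂ → L) (hdV' : ∀ k, IsCMField.complexConj L (dV' k) = dV' k) (hdV'0 : ∀ k, dV' k ≠ 0)
  -- the block data of ★ FILE 1 §3; no `Fintype ∕ DecidableEq` instance on `P Q R S` is needed here (★ `tupleVec` ∕ `frameSlotEquiv` take none)
  {P Q : Type} (R S : {v : InfinitePlace (Fp L) // v.IsReal} → Type)
  (eP : ∀ σ : {v : InfinitePlace (Fp L) // v.IsReal}, PosIdx (signVec (cmPlaceOver L) (fun k => Sum.elim (cmGramEntry L e' dV hdV (tensorFrame L dW eW dV') (tensorFrame_real L dW hdW eW dV' hdV')) (-cmGramEntry L e' dV hdV (tensorFrame L dW eW dV') (tensorFrame_real L dW hdW eW dV' hdV')) ((LocalSplitting.e₂ n').symm k)) (imagUnit L) σ) ≃ (P × R σ) ⊕ (Q × S σ))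
  (eQ : ∀ σ : {v : InfinitePlace (Fp L) // v.IsReal}, NegIdx (signVec (cmPlaceOver L) (fun k => Sum.elim (cmGramEntry L e' dV hdV (tensorFrame L dW eW dV') (tensorFrame_real L dW hdW eW dV' hdV')) (-cmGramEntry L e' dV hdV (tensorFrame L dW eW dV') (tensorFrame_real L dW hdW eW dV' hdV')) ((LocalSplitting.e₂ n').symm k)) (imagUnit L) σ) ≃ (P × S σ) ⊕ (Q × R σ))

/-- **THE HERMITE FUNCTIONS OF THE BIG FRAME ARE COMBINATIONS OF TUPLE VECTORS**: `follandHermite frameD β ∈ span (range tupleVec)` (§2 at ★ FILE 1's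
`tupleVec = tupleVecOf frameD`, `hinr := frameSlotEquiv_inr`). [cite: Folland1989, §1.7 (1.81), §4.2 Prop. (4.39)] -/
theorem follandHermite_frameD_mem_span_range_tupleVec (β : (Fin (n' + n') × {v : InfinitePlace (Fp L) // v.IsReal}) →₀ ℕ) :
    follandHermite (frameD L e' dV hdV hdV0 (tensorFrame L dW eW dV') (tensorFrame_real L dW hdW eW dV' hdV') (tensorFrame_ne_zero L dW eW dV' hdW0 hdV'0)) β ∈
      Submodule.span ℂ (Set.range (tupleVec L dV hdV hdV0 dW hdW hdW0 eW e' dV' hdV' hdV'0 R S eP eQ)) :=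
  follandHermite_mem_span_range_tupleVecOf (fun σ => unitJunctionIdx ((P × R σ) ⊕ (Q × S σ)) ((P × S σ) ⊕ (Q × R σ)))
    (frameSlotEquiv L dV hdV dW hdW eW e' dV' hdV' R S eP eQ) _ (frameSlotEquiv_inr L dV hdV dW hdW eW e' dV' hdV' R S eP eQ) β

/-- **THE TUPLE VECTORS OF THE BIG DATUM SPAN EXACTLY ITS FOCK-FINITE VECTORS**: `span (range tupleVec) = span (range (follandHermite frameD))`.
[cite: Folland1989, §1.7 (1.81), §4.2 Prop. (4.39)] [cite: Howe1989, §3] -/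
theorem span_range_tupleVec_eq_span_range_follandHermite :
    Submodule.span ℂ (Set.range (tupleVec L dV hdV hdV0 dW hdW hdW0 eW e' dV' hdV' hdV'0 R S eP eQ)) =
      Submodule.span ℂ (Set.range (follandHermite
        (frameD L e' dV hdV hdV0 (tensorFrame L dW eW dV') (tensorFrame_real L dW hdW eW dV' hdV') (tensorFrame_ne_zero L dW eW dV' hdW0 hdV'0)))) :=
  span_range_tupleVecOf_eq_span_range_follandHermite (fun σ => unitJunctionIdx ((P × R σ) ⊕ (Q × S σ)) ((P × S σ) ⊕ (Q × R σ)))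
    (frameSlotEquiv L dV hdV dW hdW eW e' dV' hdV' R S eP eQ) _ (frameSlotEquiv_inr L dV hdV dW hdW eW e' dV' hdV' R S eP eQ)

/-- monotone form: `span (range (follandHermite frameD)) ≤ span (range tupleVec)`. [cite: Folland1989, §1.7 (1.81)] -/
theorem span_range_follandHermite_le_span_range_tupleVec :
    Submodule.span ℂ (Set.range (follandHermite
        (frameD L e' dV hdV hdV0 (tensorFrame L dW eW dV') (tensorFrame_real L dW hdW eW dV' hdV') (tensorFrame_ne_zero L dW eW dV' hdW0 hdV'0)))) ≤
      Submodule.span ℂ (Set.range (tupleVec L dV hdV hdV0 dW hdW hdW0 eW e' dV' hdV' hdV'0 R S eP eQ)) :=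
  (span_range_tupleVec_eq_span_range_follandHermite L dV hdV hdV0 dW hdW hdW0 eW e' dV' hdV' hdV'0 R S eP eQ).ge

/-- **A FOCK-FINITE VECTOR OF THE BIG FRAME IS A COMBINATION OF TUPLE VECTORS** (polynomial reading): `w = frameD^*⁻¹ (B⁻¹ F)` ⇒ `w ∈ span (range tupleVec)`.
[cite: Folland1989, §1.7 (1.81), §4.2 Prop. (4.39)] [cite: Howe1989, §3] -/
theorem mem_span_range_tupleVec_of_fockFinite {w : 𝓢((Fin (n' + n') → mixedSpace (Fp L)), ℂ)}
    (hw : ∃ F : MvPolynomial (Fin (n' + n') × {v : InfinitePlace (Fp L) // v.IsReal}) ℂ,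
      w = (schwartzTransport (frameD L e' dV hdV hdV0 (tensorFrame L dW eW dV') (tensorFrame_real L dW hdW eW dV' hdV')
        (tensorFrame_ne_zero L dW eW dV' hdW0 hdV'0))).symm (binvPi F)) :
    w ∈ Submodule.span ℂ (Set.range (tupleVec L dV hdV hdV0 dW hdW hdW0 eW e' dV' hdV' hdV'0 R S eP eQ)) := by
  obtain ⟨F, rfl⟩ := hw
  exact symm_binvPi_mem_span_range_tupleVecOf (fun σ => unitJunctionIdx ((P × R σ) ⊕ (Q × S σ)) ((P × S σ) ⊕ (Q × R σ)))
    (frameSlotEquiv L dV hdV dW hdW eW e' dV' hdV' R S eP eQ) _ (frameSlotEquiv_inr L dV hdV dW hdW eW e' dV' hdV' R S eP eQ) F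

/-- **A FOCK-FINITE VECTOR OF THE BIG FRAME IS A COMBINATION OF TUPLE VECTORS** (Hermite reading): `w ∈ span (range (follandHermite frameD))` ⇒
`w ∈ span (range tupleVec)`. [cite: Folland1989, §1.7 (1.81)] [cite: Howe1989, §3] -/
theorem mem_span_range_tupleVec_of_mem_span_follandHermite {w : 𝓢((Fin (n' + n') → mixedSpace (Fp L)), ℂ)}
    (hw : w ∈ Submodule.span ℂ (Set.range (follandHermite
      (frameD L e' dV hdV hdV0 (tensorFrame L dW eW dV') (tensorFrame_real L dW hdW eW dV' hdV') (tensorFrame_ne_zero L dW eW dV' hdW0 hdV'0))))) :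
    w ∈ Submodule.span ℂ (Set.range (tupleVec L dV hdV hdV0 dW hdW hdW0 eW e' dV' hdV' hdV'0 R S eP eQ)) :=
  span_range_follandHermite_le_span_range_tupleVec L dV hdV hdV0 dW hdW hdW0 eW e' dV' hdV' hdV'0 R S eP eQ hw

/-- **THE POLYNOMIAL READING OF THE BIG DATUM**: `w ∈ span (range tupleVec) ↔ ∃ F, w = frameD^*⁻¹ (B⁻¹ F)`. [cite: Folland1989, §1.7 (1.81)] [cite: Howe1989, §3] -/
theorem mem_span_range_tupleVec_iff (w : 𝓢((Fin (n' + n') → mixedSpace (Fp L)), ℂ)) :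
    w ∈ Submodule.span ℂ (Set.range (tupleVec L dV hdV hdV0 dW hdW hdW0 eW e' dV' hdV' hdV'0 R S eP eQ)) ↔
      ∃ F : MvPolynomial (Fin (n' + n') × {v : InfinitePlace (Fp L) // v.IsReal}) ℂ,
        w = (schwartzTransport (frameD L e' dV hdV hdV0 (tensorFrame L dW eW dV') (tensorFrame_real L dW hdW eW dV' hdV')
          (tensorFrame_ne_zero L dW eW dV' hdW0 hdV'0))).symm (binvPi F) :=
  mem_span_range_tupleVecOf_iff (fun σ => unitJunctionIdx ((P × R σ) ⊕ (Q × S σ)) ((P × S σ) ⊕ (Q × R σ)))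
    (frameSlotEquiv L dV hdV dW hdW eW e' dV' hdV' R S eP eQ) _ (frameSlotEquiv_inr L dV hdV dW hdW eW e' dV' hdV' R S eP eQ) w

end BigDatum

/-! ## §4 (partner) at the model: ★ FILE 3's letter `hpartner` at `t := tupleVec` from the (E-g) polynomial-partner head BY VALUE -/

section Partner

variable (L : Type) [Field L] [NumberField L] [IsCMField L] {n : ℕ} (e : Fin 2 × Fin 1 ≃ Fin n)
  (dV : Fin 2 → L) (hdV : ∀ i, IsCMField.complexConj L (dV i) = dV i) (hdV0 : ∀ i, dV i ≠ 0)
  (dW : Fin 1 → L) (hdW : ∀ i, IsCMField.complexConj L (dW i) = dW i) (hdW0 : ∀ i, dW i ≠ 0)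
  {M' n' : ℕ} (eW : Fin 1 × Fin 3 ≃ Fin M') (e' : Fin 2 × Fin M' ≃ Fin n')
  (dV' : Fin 3 → L) (hdV' : ∀ k, IsCMField.complexConj L (dV' k) = dV' k) (hdV'0 : ∀ k, dV' k ≠ 0)
  (χb : HeckeCharacter L) (hχbu : χb.IsUnitary) (hχbs : Literature.RepresentationTheory.HarrisKudlaSweet1996.IsSplittingChar L 1 χb)
  (α : UnitaryGroup.adelicOne (Fp L) L (IsCMField.complexConj L) →* ℂˣ) (𝒦 : IwasawaDatum L e dV hdV dW hdW)
  -- the block data of ★ Final ∕ ★ FILE 2c (`P = Q = Fin 2`); no `Fintype ∕ DecidableEq` instance on `R S` is needed here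
  (R S : {v : InfinitePlace (Fp L) // v.IsReal} → Type)
  (eP : ∀ σ : {v : InfinitePlace (Fp L) // v.IsReal}, PosIdx (signVec (cmPlaceOver L) (fun k => Sum.elim (cmGramEntry L e' dV hdV (tensorFrame L dW eW dV') (tensorFrame_real L dW hdW eW dV' hdV')) (-cmGramEntry L e' dV hdV (tensorFrame L dW eW dV') (tensorFrame_real L dW hdW eW dV' hdV')) ((LocalSplitting.e₂ n').symm k)) (imagUnit L) σ) ≃ (Fin 2 × R σ) ⊕ (Fin 2 × S σ))
  (eQ : ∀ σ : {v : InfinitePlace (Fp L) // v.IsReal}, NegIdx (signVec (cmPlaceOver L) (fun k => Sum.elim (cmGramEntry L e' dV hdV (tensorFrame L dW eW dV') (tensorFrame_real L dW hdW eW dV' hdV')) (-cmGramEntry L e' dV hdV (tensorFrame L dW eW dV') (tensorFrame_real L dW hdW eW dV' hdV')) ((LocalSplitting.e₂ n').symm k)) (imagUnit L) σ) ≃ (Fin 2 × S σ) ⊕ (Fin 2 × R σ))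

/-- **(partner) FROM A HEAD VALUED IN ANY `Pf ≤ span (range tupleVec)`**: if every `a ∈ V` (`V` finite-dimensional, arch-stable) has for each `f` a partner
`w ∈ Pf` with the same generator family `g_{E(w ⊗ f)} = g_{E(a ⊗ f)}`, and `Pf ≤ span (range tupleVec)`, then ★ FILE 3 `forall_domain_good_of_archGenerators`'
letter `hpartner` holds at `t := tupleVec` — bytes :170–173 VERBATIM. [cite: Howe1989, §3] [cite: Folland1989, §1.7 (1.81)] -/
theorem hpartner_of_partnerIn (Pf : Submodule ℂ 𝓢(((Fin (n' + n')) → mixedSpace (Fp L)), ℂ))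
    (hPf : Pf ≤ Submodule.span ℂ (Set.range (tupleVec L dV hdV hdV0 dW hdW hdW0 eW e' dV' hdV' hdV'0 R S eP eQ)))
    (hEg : ∀ (V : Submodule ℂ 𝓢(((Fin (n' + n')) → mixedSpace (Fp L)), ℂ)), FiniteDimensional ℂ V → IsArchStable L e dV hdV hdV0 dW hdW hdW0 eW e' dV' hdV' hdV'0 χb hχbu hχbs 𝒦 V →
      ∀ a ∈ V, ∀ f : FinSB (Fp L) (Fin (n' + n')), ∃ w ∈ Pf,
        genFamily L e dV hdV hdV0 dW hdW hdW0 eW e' dV' hdV' hdV'0 χb hχbu hχbs α 𝒦 (piSchwartzBruhatEquiv (Fp L) (Fin (n' + n')) (w ⊗ₜ[ℂ] f)) =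
          genFamily L e dV hdV hdV0 dW hdW hdW0 eW e' dV' hdV' hdV'0 χb hχbu hχbs α 𝒦 (piSchwartzBruhatEquiv (Fp L) (Fin (n' + n')) (a ⊗ₜ[ℂ] f))) :
    ∀ (V : Submodule ℂ 𝓢(((Fin (n' + n')) → mixedSpace (Fp L)), ℂ)), FiniteDimensional ℂ V → IsArchStable L e dV hdV hdV0 dW hdW hdW0 eW e' dV' hdV' hdV'0 χb hχbu hχbs 𝒦 V →
      ∀ a ∈ V, ∀ f : FinSB (Fp L) (Fin (n' + n')), ∃ w ∈ Submodule.span ℂ (Set.range (tupleVec L dV hdV hdV0 dW hdW hdW0 eW e' dV' hdV' hdV'0 R S eP eQ)),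
        genFamily L e dV hdV hdV0 dW hdW hdW0 eW e' dV' hdV' hdV'0 χb hχbu hχbs α 𝒦 (piSchwartzBruhatEquiv (Fp L) (Fin (n' + n')) (w ⊗ₜ[ℂ] f)) =
          genFamily L e dV hdV hdV0 dW hdW hdW0 eW e' dV' hdV' hdV'0 χb hχbu hχbs α 𝒦 (piSchwartzBruhatEquiv (Fp L) (Fin (n' + n')) (a ⊗ₜ[ℂ] f)) := by
  intro V hV hst a ha f
  obtain ⟨w, hw, h⟩ := hEg V hV hst a ha f
  exact ⟨w, hPf hw, h⟩

/-- **(partner) FROM THE (E-g) HEAD IN HERMITE CURRENCY** (LH7-p05's announced `P := span (range (follandHermite frameD))`): a partner `w` in the Fock-finite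
vectors `span (range (follandHermite frameD))` of the big frame for every `a ∈ V`, `f` ⇒ ★ FILE 3's `hpartner` at `t := tupleVec` VERBATIM
(§3 `span_range_follandHermite_le_span_range_tupleVec`). [cite: Howe1989, §3] [cite: Folland1989, §1.7 (1.81), §4.2 Prop. (4.39)] -/
theorem hpartner_of_hermitePartner
    (hEg : ∀ (V : Submodule ℂ 𝓢(((Fin (n' + n')) → mixedSpace (Fp L)), ℂ)), FiniteDimensional ℂ V → IsArchStable L e dV hdV hdV0 dW hdW hdW0 eW e' dV' hdV' hdV'0 χb hχbu hχbs 𝒦 V →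
      ∀ a ∈ V, ∀ f : FinSB (Fp L) (Fin (n' + n')), ∃ w ∈ Submodule.span ℂ (Set.range (follandHermite
          (frameD L e' dV hdV hdV0 (tensorFrame L dW eW dV') (tensorFrame_real L dW hdW eW dV' hdV') (tensorFrame_ne_zero L dW eW dV' hdW0 hdV'0)))),
        genFamily L e dV hdV hdV0 dW hdW hdW0 eW e' dV' hdV' hdV'0 χb hχbu hχbs α 𝒦 (piSchwartzBruhatEquiv (Fp L) (Fin (n' + n')) (w ⊗ₜ[ℂ] f)) =
          genFamily L e dV hdV hdV0 dW hdW hdW0 eW e' dV' hdV' hdV'0 χb hχbu hχbs α 𝒦 (piSchwartzBruhatEquiv (Fp L) (Fin (n' + n')) (a ⊗ₜ[ℂ] f))) :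
    ∀ (V : Submodule ℂ 𝓢(((Fin (n' + n')) → mixedSpace (Fp L)), ℂ)), FiniteDimensional ℂ V → IsArchStable L e dV hdV hdV0 dW hdW hdW0 eW e' dV' hdV' hdV'0 χb hχbu hχbs 𝒦 V →
      ∀ a ∈ V, ∀ f : FinSB (Fp L) (Fin (n' + n')), ∃ w ∈ Submodule.span ℂ (Set.range (tupleVec L dV hdV hdV0 dW hdW hdW0 eW e' dV' hdV' hdV'0 R S eP eQ)),
        genFamily L e dV hdV hdV0 dW hdW hdW0 eW e' dV' hdV' hdV'0 χb hχbu hχbs α 𝒦 (piSchwartzBruhatEquiv (Fp L) (Fin (n' + n')) (w ⊗ₜ[ℂ] f)) =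
          genFamily L e dV hdV hdV0 dW hdW hdW0 eW e' dV' hdV' hdV'0 χb hχbu hχbs α 𝒦 (piSchwartzBruhatEquiv (Fp L) (Fin (n' + n')) (a ⊗ₜ[ℂ] f)) :=
  hpartner_of_partnerIn L e dV hdV hdV0 dW hdW hdW0 eW e' dV' hdV' hdV'0 χb hχbu hχbs α 𝒦 R S eP eQ _
    (span_range_follandHermite_le_span_range_tupleVec L dV hdV hdV0 dW hdW hdW0 eW e' dV' hdV' hdV'0 R S eP eQ) hEg

/-- **(partner) FROM THE (E-g) HEAD IN POLYNOMIAL CURRENCY**: a partner `w = frameD^*⁻¹ (B⁻¹ F)` (a polynomial × Gaussian vector of the big frame) for every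
`a ∈ V`, `f` ⇒ ★ FILE 3's `hpartner` at `t := tupleVec` VERBATIM (§3 `mem_span_range_tupleVec_of_fockFinite`). [cite: Howe1989, §3] [cite: Folland1989, §1.7 (1.81)] -/
theorem hpartner_of_polynomialPartner
    (hEg : ∀ (V : Submodule ℂ 𝓢(((Fin (n' + n')) → mixedSpace (Fp L)), ℂ)), FiniteDimensional ℂ V → IsArchStable L e dV hdV hdV0 dW hdW hdW0 eW e' dV' hdV' hdV'0 χb hχbu hχbs 𝒦 V →
      ∀ a ∈ V, ∀ f : FinSB (Fp L) (Fin (n' + n')), ∃ w : 𝓢(((Fin (n' + n')) → mixedSpace (Fp L)), ℂ),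
        (∃ F : MvPolynomial (Fin (n' + n') × {v : InfinitePlace (Fp L) // v.IsReal}) ℂ,
          w = (schwartzTransport (frameD L e' dV hdV hdV0 (tensorFrame L dW eW dV') (tensorFrame_real L dW hdW eW dV' hdV')
            (tensorFrame_ne_zero L dW eW dV' hdW0 hdV'0))).symm (binvPi F)) ∧
        genFamily L e dV hdV hdV0 dW hdW hdW0 eW e' dV' hdV' hdV'0 χb hχbu hχbs α 𝒦 (piSchwartzBruhatEquiv (Fp L) (Fin (n' + n')) (w ⊗ₜ[ℂ] f)) =
          genFamily L e dV hdV hdV0 dW hdW hdW0 eW e' dV' hdV' hdV'0 χb hχbu hχbs α 𝒦 (piSchwartzBruhatEquiv (Fp L) (Fin (n' + n')) (a ⊗ₜ[ℂ] f))) :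
    ∀ (V : Submodule ℂ 𝓢(((Fin (n' + n')) → mixedSpace (Fp L)), ℂ)), FiniteDimensional ℂ V → IsArchStable L e dV hdV hdV0 dW hdW hdW0 eW e' dV' hdV' hdV'0 χb hχbu hχbs 𝒦 V →
      ∀ a ∈ V, ∀ f : FinSB (Fp L) (Fin (n' + n')), ∃ w ∈ Submodule.span ℂ (Set.range (tupleVec L dV hdV hdV0 dW hdW hdW0 eW e' dV' hdV' hdV'0 R S eP eQ)),
        genFamily L e dV hdV hdV0 dW hdW hdW0 eW e' dV' hdV' hdV'0 χb hχbu hχbs α 𝒦 (piSchwartzBruhatEquiv (Fp L) (Fin (n' + n')) (w ⊗ₜ[ℂ] f)) =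
          genFamily L e dV hdV hdV0 dW hdW hdW0 eW e' dV' hdV' hdV'0 χb hχbu hχbs α 𝒦 (piSchwartzBruhatEquiv (Fp L) (Fin (n' + n')) (a ⊗ₜ[ℂ] f)) := by
  intro V hV hst a ha f
  obtain ⟨w, hw, h⟩ := hEg V hV hst a ha f
  exact ⟨w, mem_span_range_tupleVec_of_fockFinite L dV hdV hdV0 dW hdW hdW0 eW e' dV' hdV' hdV'0 R S eP eQ hw, h⟩

/-! ## §5 (ED. 2) The composition with the ★ (E-g) HEAD: (partner) at `t := tupleVec` from the ONE letter `hfin` by value -/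
/-- **(partner) AT `t := tupleVec` FROM THE (E-g) HEAD's ONE LETTER `hfin` BY VALUE** — ★ FILE 3's binder `hpartner` (:170–173) at `t := tupleVec`, VERBATIM, =
§4 `hpartner_of_hermitePartner` ∘ ★ p863527 `K2LiuArchSWPolynomialPartner.partner_letter_of_finiteRange` (closed-range partner ★ `exists_partner_of_tendsto_seq` on the
degree truncations ★ `tendsto_degTrunc` ∕ `degTrunc_mem_span_range`, continuity ★ `exists_clm_swSectionTensor_tmul`).  `hfin` (the head's bytes) = «for `V` fd
arch-stable and each `f`, the Siegel–Weil sections of all degree truncations `Tr_N v`, `v ∈ V`, span a finite-dimensional space of functions on `H(𝔸)`»; its discharge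
is (E-g-fin) ★ p863082 + LH7-p05's bridge (α)(β)(γ). [cite: Howe1989, §3] [cite: Folland1989, §1.7 (1.81), §4.2 Prop. (4.39)] [cite: Rudin1991, Thm. 1.21] -/
theorem hpartner_of_finiteRange
    (hfin : ∀ (V : Submodule ℂ 𝓢(((Fin (n' + n')) → mixedSpace (Fp L)), ℂ)), FiniteDimensional ℂ V →
      IsArchStable L e dV hdV hdV0 dW hdW hdW0 eW e' dV' hdV' hdV'0 χb hχbu hχbs 𝒦 V → ∀ f : FinSB (Fp L) (Fin (n' + n')),
      FiniteDimensional ℂ ↥(Submodule.span ℂ {φ : HA L e dV hdV dW hdW → ℂ | ∃ (N : ℕ) (v : 𝓢(((Fin (n' + n')) → mixedSpace (Fp L)), ℂ)), v ∈ V ∧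
      φ = fun h => swSectionTensor L e dV hdV dW hdW eW e' dV' hdV' hdV0 hdW0 hdV'0
        (doubledWeilRep L e' dV hdV hdV0 (tensorFrame L dW eW dV') (tensorFrame_real L dW hdW eW dV' hdV')
          (tensorFrame_ne_zero L dW eW dV' hdW0 hdV'0) χb hχbu hχbs)
        (piSchwartzBruhatEquiv (Fp L) (Fin (n' + n'))
          ((schwartzTransport (frameD L e' dV hdV hdV0 (tensorFrame L dW eW dV') (tensorFrame_real L dW hdW eW dV' hdV')
              (tensorFrame_ne_zero L dW eW dV' hdW0 hdV'0))).symm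
            (schwartzTransport (euclE (Fin (n' + n') × {v : InfinitePlace (Fp L) // v.IsReal}))
              (∑ d ∈ Finset.range N, degProjS d
                ((schwartzTransport (euclE (Fin (n' + n') × {v : InfinitePlace (Fp L) // v.IsReal}))).symm
                  (schwartzTransport (frameD L e' dV hdV hdV0 (tensorFrame L dW eW dV') (tensorFrame_real L dW hdW eW dV' hdV')
                    (tensorFrame_ne_zero L dW eW dV' hdW0 hdV'0)) v)))) ⊗ₜ[ℂ] f)) h})) :
    ∀ (V : Submodule ℂ 𝓢(((Fin (n' + n')) → mixedSpace (Fp L)), ℂ)), FiniteDimensional ℂ V → IsArchStable L e dV hdV hdV0 dW hdW hdW0 eW e' dV' hdV' hdV'0 χb hχbu hχbs 𝒦 V →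
      ∀ a ∈ V, ∀ f : FinSB (Fp L) (Fin (n' + n')), ∃ w ∈ Submodule.span ℂ (Set.range (tupleVec L dV hdV hdV0 dW hdW hdW0 eW e' dV' hdV' hdV'0 R S eP eQ)),
        genFamily L e dV hdV hdV0 dW hdW hdW0 eW e' dV' hdV' hdV'0 χb hχbu hχbs α 𝒦 (piSchwartzBruhatEquiv (Fp L) (Fin (n' + n')) (w ⊗ₜ[ℂ] f)) =
          genFamily L e dV hdV hdV0 dW hdW hdW0 eW e' dV' hdV' hdV'0 χb hχbu hχbs α 𝒦 (piSchwartzBruhatEquiv (Fp L) (Fin (n' + n')) (a ⊗ₜ[ℂ] f)) :=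
  hpartner_of_hermitePartner L e dV hdV hdV0 dW hdW hdW0 eW e' dV' hdV' hdV'0 χb hχbu hχbs α 𝒦 R S eP eQ
    (K2LiuArchSWPolynomialPartner.partner_letter_of_finiteRange L e dV hdV hdV0 dW hdW hdW0 eW e' dV' hdV' hdV'0 χb hχbu hχbs α 𝒦 hfin)

end Partner

end Summit.HodgeConjecture.HodgeConjecture.Cruxes.HLiu418.K2LiuArchSWDataPartnerGlue

end
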